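import Mathlib
import HarnessLib

/-!
# `GappedShellCensus.RadialDefectsVanish` (stmt-AtomisticToContinuum-15930), line `all-twelve-gap`:
# TOLERANCE TIGHTNESS of the own stub `stub_allTwelveGap`
# (registered stub `allTwelveGap_false_at_fifteen_sixteenths`)

The own stub `stub_allTwelveGap` says: a `55/57`-separated point set `Y ⊂ ℝ³` all of whose sites have
exactly twelve other sites within distance `1` has no pair of sites at distance in `(1, 21/17]`.  This
file shows that the hard-core constant cannot be lowered to `15/16 = 0.9375`: the statement with `15/16`
in place of `55/57` is FALSE.

## The witness: the body-centred tetragonal (Bain) lattice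

`Y := { v(a,b,c) | a b c : ℤ }` with `v(a,b,c) := (a + c/2, b + c/2, 21c/34) ∈ ℝ³`, i.e. the lattice
`ℤ·(1,0,0) + ℤ·(0,1,0) + ℤ·(1/2,1/2,21/34)`.  With the integer quadratic form
`Q(a,b,c) := (34a+17c)² + (34b+17c)² + 441c²` one has `dist (v p) (v q)² = Q(p - q)/1156`, so every
metric question about `Y` is a question about `Q` on `ℤ³`:

* hard core: `Q(x) ≥ 1019` for `x ≠ 0`, and `1019/1156 ≥ (15/16)²` (`1019·256 = 260864 ≥ 260100 =
  225·1156`), so `Y` is `15/16`-separated (nearest-neighbour distance `√1019/34 ≈ 0.9389`);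
* exactly twelve: `Q(x) ≤ 1156` with `x ≠ 0` iff `x` is one of the twelve triples `(±1,0,0), (0,±1,0)`
  (`Q = 1156`, distance `1`) and `(0,0,1), (-1,0,1), (0,-1,1), (-1,-1,1)` and their negatives
  (`Q = 1019`); by translation invariance every site has exactly twelve other sites within distance `1`;
* the bad pair: `v(0,0,0) = 0` and `v(-1,-1,2) = (0,0,21/17)` are distinct sites at distance EXACTLY
  `21/17` (`Q(1,1,-2) = 1764 = (21/17)²·1156`), which is neither `≤ 1` nor `> 21/17`.

The finite searches (`Q ≤ 1156 ⇒ |a|,|b|,|c| ≤ 1`, then the 27 cases) are done by `nlinarith`/`omega`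
bounding followed by `interval_cases` / `decide`.  Helpers live in the sub-namespace `RdvAtgBct`.  To
keep this `proof`-kind file free of auxiliary definitions and notations, the helpers are stated for
ARBITRARY functions `Q : ℤ³ → ℤ` and `v : ℤ³ → ℝ³` under the defining hypotheses
`hQ : ∀ x, Q x = (34 x.1 + 17 x.2.2)² + (34 x.2.1 + 17 x.2.2)² + 441 x.2.2²` and
`hv : ∀ x, v x = !₂[x.1 + x.2.2/2, x.2.1 + x.2.2/2, 21 x.2.2/34]` (section variables), which the final
theorem instantiates with the corresponding lambdas and `fun _ => rfl`.  The file is standalone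
(imports `Mathlib`, `HarnessLib` only).
-/

noncomputable section

namespace Summit.AtomisticToContinuum.Crystallization.Theorems

namespace RdvAtgBct

/-! ### The integer model: the quadratic form and the twelve short vectors -/

/-- A priori bound: `(34a+17c)² + (34b+17c)² + 441c² ≤ 1156` forces `|a|, |b|, |c| ≤ 1`. [folklore] -/
theorem box_of_Q_le {a b c : ℤ}
    (h : (34 * a + 17 * c) ^ 2 + (34 * b + 17 * c) ^ 2 + 441 * c ^ 2 ≤ 1156) :
    -1 ≤ a ∧ a ≤ 1 ∧ -1 ≤ b ∧ b ≤ 1 ∧ -1 ≤ c ∧ c ≤ 1 := by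
  have h1 := sq_nonneg (34 * a + 17 * c)
  have h2 := sq_nonneg (34 * b + 17 * c)
  have hc1 : c ≤ 1 := by nlinarith [sq_nonneg (c - 2)]
  have hc2 : -1 ≤ c := by nlinarith [sq_nonneg (c + 2)]
  have ha := abs_le_of_sq_le_sq' (show (34 * a + 17 * c) ^ 2 ≤ 34 ^ 2 by nlinarith [sq_nonneg c])
    (by norm_num)
  have hb := abs_le_of_sq_le_sq' (show (34 * b + 17 * c) ^ 2 ≤ 34 ^ 2 by nlinarith [sq_nonneg c])
    (by norm_num)
  omega

variable {Q : ℤ × ℤ × ℤ → ℤ}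
  (hQ : ∀ x, Q x = (34 * x.1 + 17 * x.2.2) ^ 2 + (34 * x.2.1 + 17 * x.2.2) ^ 2 + 441 * x.2.2 ^ 2)
include hQ

/-- The twelve nonzero integer triples with `Q ≤ 1156` (the twelve nearest sites of the bct lattice)
are `(±1,0,0), (0,±1,0)` and `±(0,0,1), ±(-1,0,1), ±(0,-1,1), ±(-1,-1,1)`. [folklore] -/
theorem mem_S12_iff (x : ℤ × ℤ × ℤ) :
    x ∈ ({(1, 0, 0), (-1, 0, 0), (0, 1, 0), (0, -1, 0), (0, 0, 1), (-1, 0, 1), (0, -1, 1),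
      (-1, -1, 1), (0, 0, -1), (1, 0, -1), (0, 1, -1), (1, 1, -1)} : Finset (ℤ × ℤ × ℤ)) ↔
      x ≠ 0 ∧ Q x ≤ 1156 := by
  rw [hQ]
  constructor
  · revert x
    decide
  · obtain ⟨a, b, c⟩ := x
    rintro ⟨hne, hle⟩
    obtain ⟨ha1, ha2, hb1, hb2, hc1, hc2⟩ := box_of_Q_le hle
    interval_cases a <;> interval_cases b <;> interval_cases c <;> simp_all

/-- Hard core in the integer model: `Q x ≥ 1019` for `x ≠ 0`. [folklore] -/
theorem le_Q_of_ne_zero (x : ℤ × ℤ × ℤ) (hx : x ≠ 0) : 1019 ≤ Q x := by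
  rw [hQ]
  obtain ⟨a, b, c⟩ := x
  by_contra hlt
  dsimp only at hlt
  obtain ⟨ha1, ha2, hb1, hb2, hc1, hc2⟩ := box_of_Q_le (a := a) (b := b) (c := c) (by omega)
  interval_cases a <;> interval_cases b <;> interval_cases c <;> simp_all

/-! ### The lattice map `v : ℤ³ → ℝ³` and its metric dictionary -/

variable {v : ℤ × ℤ × ℤ → EuclideanSpace ℝ (Fin 3)}
  (hv : ∀ x, v x = !₂[(x.1 : ℝ) + (x.2.2 : ℝ) / 2, (x.2.1 : ℝ) + (x.2.2 : ℝ) / 2, 21 * (x.2.2 : ℝ) / 34])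
include hv

/-- The metric dictionary: `dist (v p) (v q)² = Q(p - q) / 1156`. [folklore] -/
theorem dist_sq (p q : ℤ × ℤ × ℤ) : dist (v p) (v q) ^ 2 = (Q (p - q) : ℝ) / 1156 := by
  rw [EuclideanSpace.dist_sq_eq, Fin.sum_univ_three, hv, hv, hQ]
  simp only [Matrix.cons_val, Real.dist_eq, sq_abs, Prod.fst_sub, Prod.snd_sub]
  push_cast
  ring

/-- `dist (v p) (v q) ≤ 1 ↔ Q(p - q) ≤ 1156`. [folklore] -/
theorem dist_le_one_iff (p q : ℤ × ℤ × ℤ) : dist (v p) (v q) ≤ 1 ↔ Q (p - q) ≤ 1156 := by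
  rw [← sq_le_sq₀ dist_nonneg zero_le_one, dist_sq hQ hv, one_pow, div_le_one (by norm_num)]
  norm_cast

/-- `21/17 < dist (v p) (v q) ↔ 1764 < Q(p - q)`. [folklore] -/
theorem lt_dist_iff (p q : ℤ × ℤ × ℤ) : (21 : ℝ) / 17 < dist (v p) (v q) ↔ 1764 < Q (p - q) := by
  rw [← sq_lt_sq₀ (by norm_num) dist_nonneg, dist_sq hQ hv,
    lt_div_iff₀ (by norm_num : (0 : ℝ) < 1156), show ((21 : ℝ) / 17) ^ 2 * 1156 = 1764 by norm_num]
  norm_cast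

/-- Hard core in `ℝ³`: `1019 ≤ Q(p - q)` gives `15/16 ≤ dist (v p) (v q)`. [folklore] -/
theorem le_dist_of_le_Q (p q : ℤ × ℤ × ℤ) (h : 1019 ≤ Q (p - q)) :
    (15 : ℝ) / 16 ≤ dist (v p) (v q) := by
  rw [← sq_le_sq₀ (by norm_num) dist_nonneg, dist_sq hQ hv,
    le_div_iff₀ (by norm_num : (0 : ℝ) < 1156)]
  have h' : (1019 : ℝ) ≤ Q (p - q) := by exact_mod_cast h
  have h'' : ((15 : ℝ) / 16) ^ 2 * 1156 ≤ 1019 := by norm_num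
  exact h''.trans h'

/-- Distinct integer triples give sites at distance `≥ 15/16`. [folklore] -/
theorem le_dist_of_ne {p q : ℤ × ℤ × ℤ} (h : p ≠ q) : (15 : ℝ) / 16 ≤ dist (v p) (v q) :=
  le_dist_of_le_Q hQ hv p q (le_Q_of_ne_zero hQ _ (sub_ne_zero.mpr h))

/-- The lattice map `v` is injective. [folklore] -/
theorem v_injective : Function.Injective v := by
  intro p q hpq
  by_contra hne
  have h := le_dist_of_ne hQ hv hne
  rw [hpq, dist_self] at h
  norm_num at h

/-! ### The witness set `Y = range v` -/

/-- Hard core of `range v`: distinct sites are at distance `≥ 15/16`. [folklore] -/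
theorem hardCore : ∀ y ∈ Set.range v, ∀ w ∈ Set.range v, w ≠ y → (15 : ℝ) / 16 ≤ dist y w := by
  rintro _ ⟨p, rfl⟩ _ ⟨q, rfl⟩ hne
  exact le_dist_of_ne hQ hv fun h => hne (by rw [h])

/-- Every site of `range v` has exactly twelve other sites within distance `1`: the unit shell of
`v p` is the injective image `s ↦ v (p - s)` of the twelve short vectors. [folklore] -/
theorem shell_ncard (p : ℤ × ℤ × ℤ) : {w ∈ Set.range v | w ≠ v p ∧ dist (v p) w ≤ 1}.ncard = 12 := by
  have hS : {w ∈ Set.range v | w ≠ v p ∧ dist (v p) w ≤ 1} = (fun s : ℤ × ℤ × ℤ => v (p - s)) ''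
      (({(1, 0, 0), (-1, 0, 0), (0, 1, 0), (0, -1, 0), (0, 0, 1), (-1, 0, 1), (0, -1, 1),
        (-1, -1, 1), (0, 0, -1), (1, 0, -1), (0, 1, -1), (1, 1, -1)} : Finset (ℤ × ℤ × ℤ)) :
        Set (ℤ × ℤ × ℤ)) := by
    ext w
    simp only [Set.mem_setOf_eq, Set.mem_range, Set.mem_image, Finset.mem_coe]
    constructor
    · rintro ⟨⟨q, rfl⟩, hne, hd⟩
      refine ⟨p - q, ?_, by rw [sub_sub_cancel]⟩
      rw [mem_S12_iff hQ]
      exact ⟨sub_ne_zero.mpr fun h => hne (by rw [h]), (dist_le_one_iff hQ hv p q).mp hd⟩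
    · rintro ⟨s, hs, rfl⟩
      rw [mem_S12_iff hQ] at hs
      refine ⟨⟨p - s, rfl⟩, fun h => hs.1 ?_, ?_⟩
      · have h' := v_injective hQ hv h
        rwa [sub_eq_self] at h'
      · rw [dist_le_one_iff hQ hv, sub_sub_cancel]
        exact hs.2
  have hinj : Function.Injective fun s : ℤ × ℤ × ℤ => v (p - s) :=
    (v_injective hQ hv).comp (sub_right_injective (b := p))
  rw [hS, Set.ncard_image_of_injective _ hinj, Set.ncard_coe_finset]
  decide

/-- `range v` satisfies the hypotheses of the (weakened) all-twelve gap statement. [folklore] -/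
theorem hyp : ∀ y ∈ Set.range v, (∀ w ∈ Set.range v, w ≠ y → (15 : ℝ) / 16 ≤ dist y w) ∧
    {w ∈ Set.range v | w ≠ y ∧ dist y w ≤ 1}.ncard = 12 := by
  intro y hy
  refine ⟨hardCore hQ hv y hy, ?_⟩
  obtain ⟨p, rfl⟩ := hy
  exact shell_ncard hQ hv p

/-- The bad pair: `v 0 = 0` and `v (-1,-1,2) = (0,0,21/17)` are distinct sites of `range v` at
distance neither `≤ 1` nor `> 21/17` (`Q (1,1,-2) = 1764`). [folklore] -/
theorem bad_pair :
    ∃ y ∈ Set.range v, ∃ w ∈ Set.range v, w ≠ y ∧ ¬ (dist y w ≤ 1 ∨ (21 : ℝ) / 17 < dist y w) := by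
  have hne : v (-1, -1, 2) ≠ v (0, 0, 0) := fun h' => by
    have := v_injective hQ hv h'
    simp only [Prod.mk.injEq] at this
    omega
  refine ⟨_, ⟨(0, 0, 0), rfl⟩, _, ⟨(-1, -1, 2), rfl⟩, hne, ?_⟩
  rintro (h1 | h2)
  · rw [dist_le_one_iff hQ hv, hQ] at h1
    simp only [Prod.mk_sub_mk] at h1
    omega
  · rw [lt_dist_iff hQ hv, hQ] at h2
    simp only [Prod.mk_sub_mk] at h2
    omega

/-- **The witness, packaged.**  `Y = range v` is `15/16`-separated, every site has exactly twelve other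
sites within distance `1`, and it contains a pair of distinct sites at distance in `(1, 21/17]`.
[folklore] -/
theorem witness : ∃ Y : Set (EuclideanSpace ℝ (Fin 3)),
    (∀ y ∈ Y, (∀ w ∈ Y, w ≠ y → (15 : ℝ) / 16 ≤ dist y w) ∧
      {w ∈ Y | w ≠ y ∧ dist y w ≤ 1}.ncard = 12) ∧
      ∃ y ∈ Y, ∃ w ∈ Y, w ≠ y ∧ ¬ (dist y w ≤ 1 ∨ (21 : ℝ) / 17 < dist y w) :=
  ⟨Set.range v, hyp hQ hv, bad_pair hQ hv⟩

end RdvAtgBct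

/-- **TOLERANCE TIGHTNESS of `stub_allTwelveGap` (line `all-twelve-gap`).**  With hard core `15/16` in
place of `55/57` the everywhere-twelve gap statement FAILS: the body-centred tetragonal (Bain) lattice
`ℤ·(1,0,0) + ℤ·(0,1,0) + ℤ·(1/2,1/2,21/34)` is `√(1019/1156)`-separated (`> 15/16`), every site has
exactly twelve other sites within distance `1` (eight at `√1019/34 ≈ 0.9389`, four at `1`), and the
sites `0` and `(0,0,21/17)` are at distance exactly `21/17 ∈ (1, 21/17]`. [folklore] -/
theorem allTwelveGap_false_at_fifteen_sixteenths :
    ¬ (∀ Y : Set (EuclideanSpace ℝ (Fin 3)),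
      (∀ y ∈ Y, (∀ w ∈ Y, w ≠ y → (15 : ℝ) / 16 ≤ dist y w) ∧ {w ∈ Y | w ≠ y ∧ dist y w ≤ 1}.ncard = 12) →
      ∀ y ∈ Y, ∀ w ∈ Y, w ≠ y → dist y w ≤ 1 ∨ (21 : ℝ) / 17 < dist y w) := by
  intro h
  obtain ⟨Y, hY, y, hy, w, hw, hne, hbad⟩ := RdvAtgBct.witness
    (Q := fun x : ℤ × ℤ × ℤ =>
      (34 * x.1 + 17 * x.2.2) ^ 2 + (34 * x.2.1 + 17 * x.2.2) ^ 2 + 441 * x.2.2 ^ 2)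
    (v := fun x : ℤ × ℤ × ℤ =>
      !₂[(x.1 : ℝ) + (x.2.2 : ℝ) / 2, (x.2.1 : ℝ) + (x.2.2 : ℝ) / 2, 21 * (x.2.2 : ℝ) / 34])
    (fun _ => rfl) (fun _ => rfl)
  exact hbad (h Y hY y hy w hw hne)

end Summit.AtomisticToContinuum.Crystallization.Theorems
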